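import Summits.QuantumFields.YangMills.Theorems.InfiniteVolumeContinuumOnsetFloorsKTorusTransfer
import Summits.QuantumFields.YangMills.Theorems.AtomicCalibrationRMirrorCalibrationKDefs
import Summits.QuantumFields.YangMills.Theorems.BalabanLadderUVSeamRecFloorsCEngine
import Summits.QuantumFields.YangMills.Theorems.BalabanLadderUVSeamRecFloorsEngineOfReference
import HarnessLib

/-!
# Leaf `InfiniteVolumeContinuum.HypercubicOSDataFromInfiniteVolume` (stmt-QuantumFields-19868), registered stub
# N `stub_onsetFloorsK : OnsetFloorsK` — part 2/2: every NT engine bill of the tree feeds N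
# (periodic reference package of crux `NT` = stub `stub_refpkgT : RefPkgT`; frozen-boundary femto package
# `FBL ∧ FC2 ∧ FC3` = input of `stub_lower`; `NTFemto ∧ Statement.stub_fcp6` = the birth skeleton) ⇒ `LowerBoundsK` ⇒ `OnsetFloorsK`

Helper file (`--supports stmt-QuantumFields-19868`) of prover seat `ymfull-r2a-prover-1` (R590-ym item 13) on the
skeleton of record `Cruxes/HypercubicOSDataFromInfiniteVolume/Lines/octave_doubling.lean` (REV 2.1), stub N.

WHAT.  `OnsetFloorsK` (`…AtomicCalibrationRMirrorCalibrationKDefs`) is the shared onset-floor residual `OnsetFloors`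
(items 23314 / 25892, landed `onsetFloors_of_NT : BalabanLadder.NT → OnsetFloors`) with COMPACTLY SUPPORTED floor
witnesses `v, f, g, h`.  The compact supports are load-bearing downstream (slot shift with margins, K4 `B7K`), and the
soft truncation `OnsetFloors → OnsetFloorsK` is NOT available: truncating a Schwartz witness changes `Q2(θv, v)` by
contact terms across the reflection plane that no ceiling of the tree controls.  So N is not in the cone of
`BalabanLadder.NT` AS TYPED (bare Schwartz witnesses) — but it IS in the cone of the NT crux's REGISTERED ENGINE STUB:
the periodic reference package (skeleton v4T, sha16 `4297522f58b4c3a5`) asks witnesses supported in `closedBall 0 σ`,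
and part 1 transfers the floors to every torus with the same witnesses (part 1's `floor_fst/snd_of_torusReference`
are the implicit-binder variants of the landed `NT.Reference.q2/q3_floor_of_torusReference` of
`…BalabanLadderNTReferenceTorusExplicit.lean`; the seam crux's `UVSeamRec.ReferenceFloors.stubFloorsEngine_of_torusReferencePackage_rF`
is the analogous compact-witness discharge at `rF` for `stub_floorsEngine`).

* `lowerBoundsK_of_torusReferencePackage` — the package for `(r, a)` ⇒ `LowerBoundsK G r a` (K-twin of the landed
  `Reference.lowerBounds_of_torusReferencePackage`);
* `onsetFloorsK_of_lowerBoundsK` — K-twin of the landed `onsetFloors_of_NT` (onset resolution `s := a β`);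
* `onsetFloorsK_of_torusReferencePackage` — the body of `RefPkgT` VERBATIM ⇒ `OnsetFloorsK`;
* `nt_and_onsetFloorsK_of_torusReferencePackage` — the SAME engine bill gives the spine's `BalabanLadder.NT` and the
  leaf's N together (N adds no engine content beyond the registered NT stub);
* `lowerBoundsK_of_femtoPackage` — the frozen-boundary femto package `FBL ∧ FC2 ∧ FC3` for `(r, a)` (the input of the
  landed `stub_lower`, crux 9367's line `dlr-collar-transfer`) ⇒ `LowerBoundsK G r a`: this is the landed
  `UVSeamRec.FloorsC.floorsC_of_fcp` VERBATIM (its conclusion is the body of `LowerBoundsK`);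
* `onsetFloorsK_of_conditionalPackage` — K-twin of the landed `NT.Bridges.nt_of_conditionalPackage`;
* `onsetFloorsK_of_ntFemto_of_fcp6` — K-twin of the NT birth skeleton's composition: the body of `NTFemto`
  (`∀ G` compact simple `∃ (r, a)`, `TwoPointPinned ∧ Skewness`) and the engine item `Statement.stub_fcp6` ⇒ N
  (landed `UVSeamRec.FloorsC.floorsC_of_femto6`).

So N is in the cone of EACH of the tree's NT engine inputs (v4T `RefPkgT`; v1/v3 femto packages; route
`LangevinControlUV`'s 16204 ∧ 16205 ∧ `stub_fcp6` via `NT.Bridges.ntFemto_of_femtoC`), with the engine's own bump /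
ball-supported witnesses.

HONEST LABEL: a CONDITIONAL reduction (bookkeeping on the NT engine hypothesis); `RefPkgT` is open (XL, unprinted), so
N stays open; nothing here proves non-triviality, a β-uniform bound, the leaf, any crux, rung or summit; finite-volume /
conditional content only; the Yang–Mills mass gap is NOT proved.
-/

set_option autoImplicit false

noncomputable section

open scoped SchwartzMap
open MeasureTheory Filter Topology
open Literature.MathematicalPhysics.QuantumFieldTheory Literature.MathematicalPhysics.QuantumLattice
open Literature.Probability.LatticeModels
open Summit.QuantumFields.YangMills.Cruxes.OSLegsFromFemtoAndGap.DlrCollarTransfer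
open Summit.QuantumFields.YangMills.Cruxes.NT.Reference
open Summit.QuantumFields.YangMills.Cruxes.UVSeamRec.ReferenceFloors (hasCompactSupport_of_tsupport_subset_closedBall)
open Summit.QuantumFields.YangMills.Cruxes.AtomicCalibrationR.MirrorCalibration
  (LowerBoundsK OnsetFloorsK lowerBounds_of_K)

namespace Summit.QuantumFields.YangMills.Cruxes.HypercubicOSDataFromInfiniteVolume.OnsetFloorsN

section Torus

variable (G : Type) [Group G] [TopologicalSpace G] [IsTopologicalGroup G] [CompactSpace G]
  [MeasurableSpace G] [BorelSpace G] (r : LatticeRep G)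

/-- **`LowerBoundsK` from the periodic reference package.**  Units (`0 < a`, `a → 0`) + (E1/E2/E3-osc) + (R2-torus) +
(R3-torus) ⇒ the compact-witness floors `LowerBoundsK G r a` — with the package's OWN witnesses (supported in
`closedBall 0 σ`, hence compactly supported), `Λ₅ = σ + κ + 1`.  The K-twin of the landed
`Reference.lowerBounds_of_torusReferencePackage`. [folklore] -/
theorem lowerBoundsK_of_torusReferencePackage (a : ℝ → ℝ) (ha₀ : ∀ β, 0 < a β) (ha : Tendsto a atTop (𝓝 0))
    {C₁ C₂ C₃ ℓ σ κ : ℝ} (hC₁ : 0 ≤ C₁) (hC₂ : 0 ≤ C₂) (hC₃ : 0 ≤ C₃) (hσ : 0 < σ) (hκ : 0 < κ)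
    (hℓ : 2 * (σ + κ) < ℓ)
    (hE1 : ∃ β₁ : ℝ, ∀ β : ℝ, β₁ ≤ β → ∀ (c : Fin 4 → ℤ) (b : ℕ), (b : ℝ) * a β ≤ ℓ →
      ∀ (η η' : LGConfig 4 G) (x : Fin 4 → ℤ), 1 ≤ depth c b x →
        |kerE G r β c b η (dens G r x) - kerE G r β c b η' (dens G r x)| ≤ C₁ / (depth c b x : ℝ) ^ 4)
    (hE2 : ∃ β₂ : ℝ, ∀ β : ℝ, β₂ ≤ β → ∀ (c : Fin 4 → ℤ) (b : ℕ), (b : ℝ) * a β ≤ ℓ →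
      ∀ (η η' : LGConfig 4 G) (x y : Fin 4 → ℤ), 1 ≤ depth c b x → 1 ≤ depth c b y →
        |kerCov G r β c b η (dens G r x) (dens G r y) - kerCov G r β c b η' (dens G r x) (dens G r y)| ≤
          C₂ / ((min (depth c b x) (depth c b y) : ℕ) : ℝ) ^ 4 / (1 + ‖siteToE (y - x)‖) ^ 4)
    (hE3 : ∃ β₃ : ℝ, ∀ β : ℝ, β₃ ≤ β → ∀ (c : Fin 4 → ℤ) (b : ℕ), (b : ℝ) * a β ≤ ℓ →
      ∀ (η η' : LGConfig 4 G) (x y z : Fin 4 → ℤ), 1 ≤ depth c b x → 1 ≤ depth c b y → 1 ≤ depth c b z →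
        |kerK3 G r β c b η x y z - kerK3 G r β c b η' x y z| ≤
          C₃ / ((min (min (depth c b x) (depth c b y)) (depth c b z) : ℕ) : ℝ) ^ 4 /
            (1 + min (min ‖siteToE (y - x)‖ ‖siteToE (z - y)‖) ‖siteToE (z - x)‖) ^ 8)
    (hR2 : ∃ (v : 𝓢(EuclideanSpace ℝ (Fin 4), ℝ)) (ε β₅ : ℝ) (L₀ : ℝ → ℕ),
      tsupport (v : EuclideanSpace ℝ (Fin 4) → ℝ) ⊆ {y | 0 < y 0} ∧
      tsupport (v : EuclideanSpace ℝ (Fin 4) → ℝ) ⊆ Metric.closedBall 0 σ ∧ 0 < ε ∧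
      ∀ β : ℝ, β₅ ≤ β → σ + κ + 1 ≤ a β * L₀ β ∧
        ε + 2 * (C₁ * (a β / κ) ^ 4 * ∑ x ∈ box 4 (L₀ β), |thetaTest 4 v (a β • siteToE x)|) *
              (C₁ * (a β / κ) ^ 4 * ∑ y ∈ box 4 (L₀ β), |v (a β • siteToE y)|) +
            C₂ * (a β / κ) ^ 4 * ∑ x ∈ box 4 (L₀ β), ∑ y ∈ box 4 (L₀ β),
              |thetaTest 4 v (a β • siteToE x)| * |v (a β • siteToE y)| / (1 + ‖siteToE (y - x)‖) ^ 4 ≤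
          Q2 G r β (L₀ β) (a β) (thetaTest 4 v) v)
    (hR3 : ∃ (f g h : 𝓢(EuclideanSpace ℝ (Fin 4), ℝ)) (ε β₅ : ℝ) (L₀ : ℝ → ℕ),
      Disjoint (tsupport (f : EuclideanSpace ℝ (Fin 4) → ℝ)) (tsupport (g : EuclideanSpace ℝ (Fin 4) → ℝ)) ∧
      Disjoint (tsupport (g : EuclideanSpace ℝ (Fin 4) → ℝ)) (tsupport (h : EuclideanSpace ℝ (Fin 4) → ℝ)) ∧
      Disjoint (tsupport (f : EuclideanSpace ℝ (Fin 4) → ℝ)) (tsupport (h : EuclideanSpace ℝ (Fin 4) → ℝ)) ∧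
      tsupport (f : EuclideanSpace ℝ (Fin 4) → ℝ) ⊆ Metric.closedBall 0 σ ∧
      tsupport (g : EuclideanSpace ℝ (Fin 4) → ℝ) ⊆ Metric.closedBall 0 σ ∧
      tsupport (h : EuclideanSpace ℝ (Fin 4) → ℝ) ⊆ Metric.closedBall 0 σ ∧ 0 < ε ∧
      ∀ β : ℝ, β₅ ≤ β → σ + κ + 1 ≤ a β * L₀ β ∧
        ε + ∑ x ∈ box 4 (L₀ β), ∑ y ∈ box 4 (L₀ β), ∑ z ∈ box 4 (L₀ β),
            |f (a β • siteToE x)| * |g (a β • siteToE y)| * |h (a β • siteToE z)| *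
              (2 * ((C₁ * (a β / κ) ^ 4) * (C₂ * (a β / κ) ^ 4 / (1 + ‖siteToE (z - y)‖) ^ 4) +
                    (C₁ * (a β / κ) ^ 4) * (C₂ * (a β / κ) ^ 4 / (1 + ‖siteToE (z - x)‖) ^ 4) +
                    (C₁ * (a β / κ) ^ 4) * (C₂ * (a β / κ) ^ 4 / (1 + ‖siteToE (y - x)‖) ^ 4) +
                    (C₁ * (a β / κ) ^ 4) * (C₁ * (a β / κ) ^ 4) * (C₁ * (a β / κ) ^ 4)) +
                C₃ * (a β / κ) ^ 4 / (1 + min (min ‖siteToE (y - x)‖ ‖siteToE (z - y)‖) ‖siteToE (z - x)‖) ^ 8) ≤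
          |Q3 G r β (L₀ β) (a β) f g h|) :
    LowerBoundsK G r a := by
  obtain ⟨v, ε, β₅, L₀, hvpos, hvσ, hε, HR⟩ := hR2
  obtain ⟨f, g, h, ε', β₅', L₀', hfg, hgh, hfh, hfσ, hgσ, hhσ, hε', HR'⟩ := hR3
  obtain ⟨b₅, hb₅⟩ := floor_fst_of_torusReference G r a ha₀ ha hC₁ hC₂ hσ hκ hℓ hE1 hE2 hvσ HR
  obtain ⟨b₅', hb₅'⟩ :=
    floor_snd_of_torusReference G r a ha₀ ha hC₁ hC₂ hC₃ hσ hκ hℓ hE1 hE2 hE3 hfσ hgσ hhσ HR'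
  exact ⟨⟨v, ε, b₅, σ + κ + 1, hasCompactSupport_of_tsupport_subset_closedBall hvσ, hvpos, hε, hb₅⟩,
    ⟨f, g, h, ε', b₅', σ + κ + 1, hasCompactSupport_of_tsupport_subset_closedBall hfσ,
      hasCompactSupport_of_tsupport_subset_closedBall hgσ, hasCompactSupport_of_tsupport_subset_closedBall hhσ,
      hfg, hgh, hfh, hε', hb₅'⟩⟩

end Torus

/-- **`OnsetFloorsK` from `LowerBoundsK` at a vanishing unit** — the compact-witness twin of the landed
`OnsetCalibration.onsetFloors_of_NT`: if every SU(2)-class `G` carries, for one `(r, a)` with `0 < a`, `a → 0`, the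
compact-witness floors `LowerBoundsK G r a`, then `OnsetFloorsK` (onset resolution `s := a β`, `ε := min`, `Λ₅ := max`,
`β₅ := max` of the thresholds and of a point past which `a β ≤ 1`). [folklore] -/
theorem onsetFloorsK_of_lowerBoundsK
    (h : ∀ (G : Type) [Group G] [TopologicalSpace G] [IsTopologicalGroup G] [CompactSpace G],
      IsCompactSimpleLieGroup G → Nonempty (G ≃ₜ* Matrix.specialUnitaryGroup (Fin 2) ℂ) →
      letI : MeasurableSpace G := borel G; haveI : BorelSpace G := ⟨rfl⟩;
      ∃ (r : LatticeRep G) (a : ℝ → ℝ), (∀ β, 0 < a β) ∧ Tendsto a atTop (𝓝 0) ∧ LowerBoundsK G r a) :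
    OnsetFloorsK := by
  intro G _ _ _ _ hG hcl
  letI : MeasurableSpace G := borel G
  haveI : BorelSpace G := ⟨rfl⟩
  obtain ⟨r, a, ha, ha0, ⟨v, ε₂, β₂, Λ₂, hvK, hv, hε₂, h2⟩,
    ⟨f, g, h', ε₃, β₃, Λ₃, hfK, hgK, hhK, hfg, hgh, hfh, hε₃, h3⟩⟩ := h G hG hcl
  -- past `β₁` the unit is at most `1`
  obtain ⟨β₁, hβ₁⟩ := Filter.eventually_atTop.1 ((tendsto_order.1 ha0).2 1 one_pos)
  refine ⟨r, v, f, g, h', min ε₂ ε₃, max Λ₂ Λ₃, max (max β₂ β₃) β₁, hvK, hfK, hgK, hhK, hv, hfg, hgh, hfh,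
    lt_min hε₂ hε₃, ?_⟩
  intro β hβ
  have hβ₂ : β₂ ≤ β := le_trans (le_max_left _ _) (le_trans (le_max_left _ _) hβ)
  have hβ₃ : β₃ ≤ β := le_trans (le_max_right _ _) (le_trans (le_max_left _ _) hβ)
  have hβ₁' : β₁ ≤ β := le_trans (le_max_right _ _) hβ
  refine ⟨a β, ha β, (hβ₁ β hβ₁').le, fun L hL => ?_, fun L hL => ?_⟩
  · exact (min_le_left _ _).trans (h2 β hβ₂ L ((le_max_left _ _).trans hL))
  · exact (min_le_right _ _).trans (h3 β hβ₃ L ((le_max_right _ _).trans hL))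

/-- **N from the NT engine bill.**  The body of the registered stub `stub_refpkgT : RefPkgT` of crux `NT`
(stmt-QuantumFields-19353, skeleton v4T «periodic-reference») VERBATIM — for every compact simple `G` one `(r, a)`
(`0 < a`, `a → 0`), constants `C₁, C₂, C₃ ≥ 0`, femto scale `ℓ`, support radius `σ > 0`, collar `κ > 0`
(`2(σ+κ) < ℓ`), the three sign-free exterior-oscillation ceilings (E1/E2/E3-osc) on femto cubes, and the two floors
with margin on ONE torus per coupling for witnesses supported in `closedBall 0 σ` — implies the leaf's registered stub
N `OnsetFloorsK` (compact witnesses = the package's own).  Conditional reduction; `RefPkgT` is open. [folklore] -/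
theorem onsetFloorsK_of_torusReferencePackage
    (h : ∀ (G : Type) [Group G] [TopologicalSpace G] [IsTopologicalGroup G] [CompactSpace G],
      IsCompactSimpleLieGroup G → letI : MeasurableSpace G := borel G; haveI : BorelSpace G := ⟨rfl⟩;
      ∃ (r : LatticeRep G) (a : ℝ → ℝ), (∀ β, 0 < a β) ∧ Tendsto a atTop (𝓝 0) ∧
      ∃ (C₁ C₂ C₃ ℓ σ κ : ℝ), 0 ≤ C₁ ∧ 0 ≤ C₂ ∧ 0 ≤ C₃ ∧ 0 < σ ∧ 0 < κ ∧ 2 * (σ + κ) < ℓ ∧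
      (∃ β₁ : ℝ, ∀ β : ℝ, β₁ ≤ β → ∀ (c : Fin 4 → ℤ) (b : ℕ), (b : ℝ) * a β ≤ ℓ →
        ∀ (η η' : LGConfig 4 G) (x : Fin 4 → ℤ), 1 ≤ depth c b x →
          |kerE G r β c b η (dens G r x) - kerE G r β c b η' (dens G r x)| ≤ C₁ / (depth c b x : ℝ) ^ 4) ∧
      (∃ β₂ : ℝ, ∀ β : ℝ, β₂ ≤ β → ∀ (c : Fin 4 → ℤ) (b : ℕ), (b : ℝ) * a β ≤ ℓ →
        ∀ (η η' : LGConfig 4 G) (x y : Fin 4 → ℤ), 1 ≤ depth c b x → 1 ≤ depth c b y →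
          |kerCov G r β c b η (dens G r x) (dens G r y) - kerCov G r β c b η' (dens G r x) (dens G r y)| ≤
            C₂ / ((min (depth c b x) (depth c b y) : ℕ) : ℝ) ^ 4 / (1 + ‖siteToE (y - x)‖) ^ 4) ∧
      (∃ β₃ : ℝ, ∀ β : ℝ, β₃ ≤ β → ∀ (c : Fin 4 → ℤ) (b : ℕ), (b : ℝ) * a β ≤ ℓ →
        ∀ (η η' : LGConfig 4 G) (x y z : Fin 4 → ℤ), 1 ≤ depth c b x → 1 ≤ depth c b y → 1 ≤ depth c b z →
          |kerK3 G r β c b η x y z - kerK3 G r β c b η' x y z| ≤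
            C₃ / ((min (min (depth c b x) (depth c b y)) (depth c b z) : ℕ) : ℝ) ^ 4 /
              (1 + min (min ‖siteToE (y - x)‖ ‖siteToE (z - y)‖) ‖siteToE (z - x)‖) ^ 8) ∧
      (∃ (v : 𝓢(EuclideanSpace ℝ (Fin 4), ℝ)) (ε β₅ : ℝ) (L₀ : ℝ → ℕ),
        tsupport (v : EuclideanSpace ℝ (Fin 4) → ℝ) ⊆ {y | 0 < y 0} ∧
        tsupport (v : EuclideanSpace ℝ (Fin 4) → ℝ) ⊆ Metric.closedBall 0 σ ∧ 0 < ε ∧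
        ∀ β : ℝ, β₅ ≤ β → σ + κ + 1 ≤ a β * L₀ β ∧
          ε + 2 * (C₁ * (a β / κ) ^ 4 * ∑ x ∈ box 4 (L₀ β), |thetaTest 4 v (a β • siteToE x)|) *
                (C₁ * (a β / κ) ^ 4 * ∑ y ∈ box 4 (L₀ β), |v (a β • siteToE y)|) +
              C₂ * (a β / κ) ^ 4 * ∑ x ∈ box 4 (L₀ β), ∑ y ∈ box 4 (L₀ β),
                |thetaTest 4 v (a β • siteToE x)| * |v (a β • siteToE y)| / (1 + ‖siteToE (y - x)‖) ^ 4 ≤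
            Q2 G r β (L₀ β) (a β) (thetaTest 4 v) v) ∧
      (∃ (f g h : 𝓢(EuclideanSpace ℝ (Fin 4), ℝ)) (ε β₅ : ℝ) (L₀ : ℝ → ℕ),
        Disjoint (tsupport (f : EuclideanSpace ℝ (Fin 4) → ℝ)) (tsupport (g : EuclideanSpace ℝ (Fin 4) → ℝ)) ∧
        Disjoint (tsupport (g : EuclideanSpace ℝ (Fin 4) → ℝ)) (tsupport (h : EuclideanSpace ℝ (Fin 4) → ℝ)) ∧
        Disjoint (tsupport (f : EuclideanSpace ℝ (Fin 4) → ℝ)) (tsupport (h : EuclideanSpace ℝ (Fin 4) → ℝ)) ∧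
        tsupport (f : EuclideanSpace ℝ (Fin 4) → ℝ) ⊆ Metric.closedBall 0 σ ∧
        tsupport (g : EuclideanSpace ℝ (Fin 4) → ℝ) ⊆ Metric.closedBall 0 σ ∧
        tsupport (h : EuclideanSpace ℝ (Fin 4) → ℝ) ⊆ Metric.closedBall 0 σ ∧ 0 < ε ∧
        ∀ β : ℝ, β₅ ≤ β → σ + κ + 1 ≤ a β * L₀ β ∧
          ε + ∑ x ∈ box 4 (L₀ β), ∑ y ∈ box 4 (L₀ β), ∑ z ∈ box 4 (L₀ β),
              |f (a β • siteToE x)| * |g (a β • siteToE y)| * |h (a β • siteToE z)| *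
                (2 * ((C₁ * (a β / κ) ^ 4) * (C₂ * (a β / κ) ^ 4 / (1 + ‖siteToE (z - y)‖) ^ 4) +
                      (C₁ * (a β / κ) ^ 4) * (C₂ * (a β / κ) ^ 4 / (1 + ‖siteToE (z - x)‖) ^ 4) +
                      (C₁ * (a β / κ) ^ 4) * (C₂ * (a β / κ) ^ 4 / (1 + ‖siteToE (y - x)‖) ^ 4) +
                      (C₁ * (a β / κ) ^ 4) * (C₁ * (a β / κ) ^ 4) * (C₁ * (a β / κ) ^ 4)) +
                  C₃ * (a β / κ) ^ 4 /
                    (1 + min (min ‖siteToE (y - x)‖ ‖siteToE (z - y)‖) ‖siteToE (z - x)‖) ^ 8) ≤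
            |Q3 G r β (L₀ β) (a β) f g h|)) :
    OnsetFloorsK := by
  refine onsetFloorsK_of_lowerBoundsK fun G _ _ _ _ hG _ => ?_
  letI : MeasurableSpace G := borel G
  haveI : BorelSpace G := ⟨rfl⟩
  obtain ⟨r, a, ha₀, ha, C₁, C₂, C₃, ℓ, σ, κ, hC₁, hC₂, hC₃, hσ, hκ, hℓ, hE1, hE2, hE3, hR2, hR3⟩ := h G hG
  exact ⟨r, a, ha₀, ha,
    lowerBoundsK_of_torusReferencePackage G r a ha₀ ha hC₁ hC₂ hC₃ hσ hκ hℓ hE1 hE2 hE3 hR2 hR3⟩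

/-- **One engine bill, two residuals.**  The periodic reference package (the body of `RefPkgT`) gives BOTH the
spine's non-triviality crux `BalabanLadder.NT` (as the landed `Reference.nt_of_torusReferencePackage`, here via
`lowerBounds_of_K`) AND the leaf's
compact-witness stub N `OnsetFloorsK` — so N adds no engine content beyond the registered NT stub. [folklore] -/
theorem nt_and_onsetFloorsK_of_torusReferencePackage
    (h : ∀ (G : Type) [Group G] [TopologicalSpace G] [IsTopologicalGroup G] [CompactSpace G],
      IsCompactSimpleLieGroup G → letI : MeasurableSpace G := borel G; haveI : BorelSpace G := ⟨rfl⟩;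
      ∃ (r : LatticeRep G) (a : ℝ → ℝ), (∀ β, 0 < a β) ∧ Tendsto a atTop (𝓝 0) ∧
      ∃ (C₁ C₂ C₃ ℓ σ κ : ℝ), 0 ≤ C₁ ∧ 0 ≤ C₂ ∧ 0 ≤ C₃ ∧ 0 < σ ∧ 0 < κ ∧ 2 * (σ + κ) < ℓ ∧
      (∃ β₁ : ℝ, ∀ β : ℝ, β₁ ≤ β → ∀ (c : Fin 4 → ℤ) (b : ℕ), (b : ℝ) * a β ≤ ℓ →
        ∀ (η η' : LGConfig 4 G) (x : Fin 4 → ℤ), 1 ≤ depth c b x →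
          |kerE G r β c b η (dens G r x) - kerE G r β c b η' (dens G r x)| ≤ C₁ / (depth c b x : ℝ) ^ 4) ∧
      (∃ β₂ : ℝ, ∀ β : ℝ, β₂ ≤ β → ∀ (c : Fin 4 → ℤ) (b : ℕ), (b : ℝ) * a β ≤ ℓ →
        ∀ (η η' : LGConfig 4 G) (x y : Fin 4 → ℤ), 1 ≤ depth c b x → 1 ≤ depth c b y →
          |kerCov G r β c b η (dens G r x) (dens G r y) - kerCov G r β c b η' (dens G r x) (dens G r y)| ≤
            C₂ / ((min (depth c b x) (depth c b y) : ℕ) : ℝ) ^ 4 / (1 + ‖siteToE (y - x)‖) ^ 4) ∧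
      (∃ β₃ : ℝ, ∀ β : ℝ, β₃ ≤ β → ∀ (c : Fin 4 → ℤ) (b : ℕ), (b : ℝ) * a β ≤ ℓ →
        ∀ (η η' : LGConfig 4 G) (x y z : Fin 4 → ℤ), 1 ≤ depth c b x → 1 ≤ depth c b y → 1 ≤ depth c b z →
          |kerK3 G r β c b η x y z - kerK3 G r β c b η' x y z| ≤
            C₃ / ((min (min (depth c b x) (depth c b y)) (depth c b z) : ℕ) : ℝ) ^ 4 /
              (1 + min (min ‖siteToE (y - x)‖ ‖siteToE (z - y)‖) ‖siteToE (z - x)‖) ^ 8) ∧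
      (∃ (v : 𝓢(EuclideanSpace ℝ (Fin 4), ℝ)) (ε β₅ : ℝ) (L₀ : ℝ → ℕ),
        tsupport (v : EuclideanSpace ℝ (Fin 4) → ℝ) ⊆ {y | 0 < y 0} ∧
        tsupport (v : EuclideanSpace ℝ (Fin 4) → ℝ) ⊆ Metric.closedBall 0 σ ∧ 0 < ε ∧
        ∀ β : ℝ, β₅ ≤ β → σ + κ + 1 ≤ a β * L₀ β ∧
          ε + 2 * (C₁ * (a β / κ) ^ 4 * ∑ x ∈ box 4 (L₀ β), |thetaTest 4 v (a β • siteToE x)|) *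
                (C₁ * (a β / κ) ^ 4 * ∑ y ∈ box 4 (L₀ β), |v (a β • siteToE y)|) +
              C₂ * (a β / κ) ^ 4 * ∑ x ∈ box 4 (L₀ β), ∑ y ∈ box 4 (L₀ β),
                |thetaTest 4 v (a β • siteToE x)| * |v (a β • siteToE y)| / (1 + ‖siteToE (y - x)‖) ^ 4 ≤
            Q2 G r β (L₀ β) (a β) (thetaTest 4 v) v) ∧
      (∃ (f g h : 𝓢(EuclideanSpace ℝ (Fin 4), ℝ)) (ε β₅ : ℝ) (L₀ : ℝ → ℕ),
        Disjoint (tsupport (f : EuclideanSpace ℝ (Fin 4) → ℝ)) (tsupport (g : EuclideanSpace ℝ (Fin 4) → ℝ)) ∧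
        Disjoint (tsupport (g : EuclideanSpace ℝ (Fin 4) → ℝ)) (tsupport (h : EuclideanSpace ℝ (Fin 4) → ℝ)) ∧
        Disjoint (tsupport (f : EuclideanSpace ℝ (Fin 4) → ℝ)) (tsupport (h : EuclideanSpace ℝ (Fin 4) → ℝ)) ∧
        tsupport (f : EuclideanSpace ℝ (Fin 4) → ℝ) ⊆ Metric.closedBall 0 σ ∧
        tsupport (g : EuclideanSpace ℝ (Fin 4) → ℝ) ⊆ Metric.closedBall 0 σ ∧
        tsupport (h : EuclideanSpace ℝ (Fin 4) → ℝ) ⊆ Metric.closedBall 0 σ ∧ 0 < ε ∧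
        ∀ β : ℝ, β₅ ≤ β → σ + κ + 1 ≤ a β * L₀ β ∧
          ε + ∑ x ∈ box 4 (L₀ β), ∑ y ∈ box 4 (L₀ β), ∑ z ∈ box 4 (L₀ β),
              |f (a β • siteToE x)| * |g (a β • siteToE y)| * |h (a β • siteToE z)| *
                (2 * ((C₁ * (a β / κ) ^ 4) * (C₂ * (a β / κ) ^ 4 / (1 + ‖siteToE (z - y)‖) ^ 4) +
                      (C₁ * (a β / κ) ^ 4) * (C₂ * (a β / κ) ^ 4 / (1 + ‖siteToE (z - x)‖) ^ 4) +
                      (C₁ * (a β / κ) ^ 4) * (C₂ * (a β / κ) ^ 4 / (1 + ‖siteToE (y - x)‖) ^ 4) +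
                      (C₁ * (a β / κ) ^ 4) * (C₁ * (a β / κ) ^ 4) * (C₁ * (a β / κ) ^ 4)) +
                  C₃ * (a β / κ) ^ 4 /
                    (1 + min (min ‖siteToE (y - x)‖ ‖siteToE (z - y)‖) ‖siteToE (z - x)‖) ^ 8) ≤
            |Q3 G r β (L₀ β) (a β) f g h|)) :
    Summit.QuantumFields.YangMills.Theses.BalabanLadder.NT ∧ OnsetFloorsK := by
  refine ⟨fun G _ _ _ _ hG => ?_, onsetFloorsK_of_torusReferencePackage h⟩
  letI : MeasurableSpace G := borel G
  haveI : BorelSpace G := ⟨rfl⟩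
  obtain ⟨r, a, ha₀, ha, C₁, C₂, C₃, ℓ, σ, κ, hC₁, hC₂, hC₃, hσ, hκ, hℓ, hE1, hE2, hE3, hR2, hR3⟩ := h G hG
  exact ⟨r, a, ha₀, ha,
    lowerBounds_of_K (lowerBoundsK_of_torusReferencePackage G r a ha₀ ha hC₁ hC₂ hC₃ hσ hκ hℓ hE1 hE2 hE3 hR2 hR3)⟩


/-! ## The frozen-boundary femto package (input of `stub_lower`) and the NT birth skeleton feed N as well -/

section Femto

variable (G : Type) [Group G] [TopologicalSpace G] [IsTopologicalGroup G] [CompactSpace G]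
  [MeasurableSpace G] [BorelSpace G] (r : LatticeRep G) (a : ℝ → ℝ)

/-- **`LowerBoundsK` from the frozen-boundary femto package** `FBL ∧ FC2 ∧ FC3` at a unit map `a > 0`, `a → 0`
(the input of the landed `stub_lower : … → LowerBounds G r a`): the landed compact-witness re-run
`UVSeamRec.FloorsC.floorsC_of_fcp`, whose conclusion is the body of `LowerBoundsK G r a` verbatim (bump witnesses,
`tsupport = closedBall`). [folklore] -/
theorem lowerBoundsK_of_femtoPackage (hapos : ∀ β, 0 < a β) (hlim : Tendsto a atTop (𝓝 0))
    (hFBL : FBL G r a) (hFC2 : FC2 G r a) (hFC3 : FC3 G r a) : LowerBoundsK G r a :=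
  Summit.QuantumFields.YangMills.Cruxes.UVSeamRec.FloorsC.floorsC_of_fcp G r a hapos hlim hFBL hFC2 hFC3

/-- **`LowerBoundsK` from the femto torus packages and the engine item** — `TwoPointPinned G r a`, `Skewness G r a`
(the body of the NT birth skeleton's `NTFemto` for this `(r, a)`) and `Statement.stub_fcp6` (engine item of crux
stmt-QuantumFields-9367, line `dlr-collar-transfer`) give `LowerBoundsK G r a` (landed
`UVSeamRec.FloorsC.floorsC_of_femto6`, through `fbl_of_fbl6`). [conditional bridge] -/
theorem lowerBoundsK_of_femto6 (hG : IsCompactSimpleLieGroup G) (hfcp : Statement.stub_fcp6)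
    (hTP : TwoPointPinned G r a) (hSk : Skewness G r a) : LowerBoundsK G r a :=
  Summit.QuantumFields.YangMills.Cruxes.UVSeamRec.FloorsC.floorsC_of_femto6 G r a hG hfcp hTP hSk

end Femto

/-- **N from the conditional femto package** — K-twin of the landed `NT.Bridges.nt_of_conditionalPackage`: if every
SU(2)-class `G` carries, for one `(r, a)` (`0 < a`, `a → 0`), the frozen-boundary femto package
`FBL G r a ∧ FC2 G r a ∧ FC3 G r a`, then `OnsetFloorsK`. [folklore] -/
theorem onsetFloorsK_of_conditionalPackage
    (h : ∀ (G : Type) [Group G] [TopologicalSpace G] [IsTopologicalGroup G] [CompactSpace G],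
      IsCompactSimpleLieGroup G → letI : MeasurableSpace G := borel G; haveI : BorelSpace G := ⟨rfl⟩;
      ∃ (r : LatticeRep G) (a : ℝ → ℝ), (∀ β, 0 < a β) ∧ Tendsto a atTop (𝓝 0) ∧
        FBL G r a ∧ FC2 G r a ∧ FC3 G r a) :
    OnsetFloorsK := by
  refine onsetFloorsK_of_lowerBoundsK fun G _ _ _ _ hG _ => ?_
  letI : MeasurableSpace G := borel G
  haveI : BorelSpace G := ⟨rfl⟩
  obtain ⟨r, a, ha, ha0, hfbl, hfc2, hfc3⟩ := h G hG
  exact ⟨r, a, ha, ha0, lowerBoundsK_of_femtoPackage G r a ha ha0 hfbl hfc2 hfc3⟩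

/-- **N from the NT birth skeleton's two stubs** — the body of `NTFemto` (for every compact simple `G` one `(r, a)`
with `TwoPointPinned G r a ∧ Skewness G r a`; = route `LangevinControlUV`'s items 16204 ∧ 16205 by the landed
`NT.Bridges.ntFemto_of_femtoC`) and the engine item `Statement.stub_fcp6` imply `OnsetFloorsK` (units `0 < a`,
`a → 0` are clauses of `TwoPointPinned`). [conditional bridge] -/
theorem onsetFloorsK_of_ntFemto_of_fcp6 (hfcp : Statement.stub_fcp6)
    (h : ∀ (G : Type) [Group G] [TopologicalSpace G] [IsTopologicalGroup G] [CompactSpace G],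
      IsCompactSimpleLieGroup G → letI : MeasurableSpace G := borel G; haveI : BorelSpace G := ⟨rfl⟩;
      ∃ (r : LatticeRep G) (a : ℝ → ℝ), TwoPointPinned G r a ∧ Skewness G r a) :
    OnsetFloorsK := by
  refine onsetFloorsK_of_lowerBoundsK fun G _ _ _ _ hG _ => ?_
  letI : MeasurableSpace G := borel G
  haveI : BorelSpace G := ⟨rfl⟩
  obtain ⟨r, a, hTP, hSk⟩ := h G hG
  have hunits := hTP
  obtain ⟨Γ, β₀, ℓ₀, c, C, -, -, ha, ha0, -⟩ := hunits
  exact ⟨r, a, ha, ha0, lowerBoundsK_of_femto6 G r a hG hfcp hTP hSk⟩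

end Summit.QuantumFields.YangMills.Cruxes.HypercubicOSDataFromInfiniteVolume.OnsetFloorsN

end
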